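import Summits.QuantumFields.BalabanUV.T4Continuum.Support.RegionGaugeScattered
import Mathlib.Algebra.Order.Chebyshev

/-!
# `BalabanUV.T4Continuum.Support.RegionGaugeSparse` — NE2 (node U1a) formalisation swarm, SUPPLIER item «Δ1-VEC-W1-HOLED» under the
# owner's sub-row `T4-U1a.S-NE2-D1-DIRICHLET°` (vector layer W1), file 6: **W1 WITH ONE LEVEL-UNIFORM CONSTANT ON THE COMPLEMENT OF ANY
# SPARSE SET OF BLOCKS** — finitely many exterior blocks, none in the `3^d`-collar of another (ℓ∞ block distance ≥ 2: ONE block of `S`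
# between any two holes suffices; overlapping collars allowed) «not in print; our construction» (unit b2b-balaban-t4-ne2-formalise-leaf-09, gen 9, v1)

HONEST FRAMING (T4-DAG p. 1).  [folklore] `U = 1`, the faithful single-scale star-bond operator, ONE region `S = T ∖ E`, `E` SPARSE:
`cblk w k ≠ w′` for `w ≠ w′` in `E` and every offset `k ∈ {0,1,2}^d` (`3 ≤ M_ν`).  Same argument as `RegionGaugeScattered` (disjoint collars,
ℓ∞ ≥ 3) with ONE change: the collars may now OVERLAP (in the blocks of `S` between two holes), and the gradient of `λ = Σ_{w∈E} lift_w μ̃` is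
bounded with the MULTIPLICITY of the cover — at most `3^d` collars through any site (the holes within ℓ∞ ≤ 1 of a block inject into
`{0,1,2}^d`) — by Cauchy–Schwarz: `nsq (∂λ) ≤ 3^d·Σ_w nsq (∂ lift_w μ̃)`.  Constant **`sparseConst d a a′ = orbitConst d a (K₂/γ_D) (K₂ a/γ_D) /
(1 + 4d/σ₀)`, `K₂ = 2 + 4(d+1)·9^d`** — free of `n`, `M`, `E`.  Diagonal CONTACTS (ℓ∞ = 1 without a shared face) are excluded by the
hypothesis — rightly: there W1 with one constant is FALSE (`RegionGaugeContactNoGo`); adjacent holes (exterior components of ≥ 2 blocks) are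
NOT treated.  Nothing printed is a hypothesis; NE2 (U1a) NOT proved; spine PROVED 0/9 unchanged; NOT [B9] (3.16)∕(3.23)–(3.27) as printed; NOT
infinite volume, NOT the mass gap, NOT Clay.  HONEST DEPENDENCY (verbatim): «continuum YM on T⁴ ⇐ BetaPertH ∧ nine spine estimates (0/9
proved); BetaPertH ⇐ (D1) ∧ (D4) ∧ CAP+tail; G-an2-4 gates asym, D1 and NE2/3/4.»

ABSOLUTE RULE (cell, verbatim): «No internally-minted statement may enter as a cited fact. Every hypothesis is either kernel-proved in
this package or a verbatim quotation of a PUBLISHED theorem with page reference. The manuscript(s) under audit are NOT citable for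
their own disputed steps — they are the thing under adjudication; programme-internal (2001/route/tribunal) claims are never citable.»
[folklore] throughout; two real constants (`Ksparse`, `sparseConst`), no other def, no `def … : Prop` (sparseness is a plain `∀` hypothesis on
the finite set `E`).  NOT CLAIMED: adjacent holes; W3̃; NE2; NE3.
-/

noncomputable section

open scoped BigOperators ComplexConjugate Matrix Matrix.Norms.L2Operator
open Finset

namespace Summit.QuantumFields.BalabanUV.T4Continuum.RegionGaugeSparse

open Literature.MathematicalPhysics.QuantumFieldTheory.Balaban1983to89.B5Prop11Plancherel (Tor fine unitVec)
open Literature.MathematicalPhysics.QuantumFieldTheory.Balaban1983to89.B5Prop11Lower (nsq nsq_nonneg)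
open Literature.MathematicalPhysics.QuantumFieldTheory.Balaban1983to89.B5Action121 (GradOp GradOp_mulVec sdiff sdiff_mulVec)
open Literature.MathematicalPhysics.QuantumFieldTheory.Balaban1983to89.B5Block118 (bpt QsOp)
open Literature.MathematicalPhysics.QuantumFieldTheory.Balaban1983to89.B5Blocks16 (blockOf blockOf_bpt)
open Literature.MathematicalPhysics.QuantumFieldTheory.Balaban1983to89.B5G183RateUnitTower (lev)
open Summit.QuantumFields.BalabanUV.T4Continuum
open Summit.QuantumFields.BalabanUV.T4Continuum.SubtypeCompression (Coercive ext ext_apply_of ext_apply_of_not nsq_ext)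
open Summit.QuantumFields.BalabanUV.T4Continuum.ScalarAveragedPropagator (gammaPs)
open Summit.QuantumFields.BalabanUV.T4Continuum.ScalarAveragedCompression (sigma0 sigma0_pos)
open Summit.QuantumFields.BalabanUV.T4Continuum.RegionScalarCompression (QOm GOm)
open Summit.QuantumFields.BalabanUV.T4Continuum.RegionGaugeFixedVector (starReg curlR gradR avgR regionDeltaA)
open Summit.QuantumFields.BalabanUV.T4Continuum.RegionGaugeSlice (SliceCoercive)
open Summit.QuantumFields.BalabanUV.T4Continuum.RegionGaugeSliceOrth (OrthSliceCoercive)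
open Summit.QuantumFields.BalabanUV.T4Continuum.RegionGaugeSliceOrthRegion (sliceCoercive_region_of_orthSlice
  coercive_regionDeltaA_of_orthSlice opNorm_inv_regionDeltaA_le_of_orthSlice)
open Summit.QuantumFields.BalabanUV.T4Continuum.RegionGaugeOrbit (orbitConst orbitConst_pos orthSlice_of_gaugePoincare)
open Summit.QuantumFields.BalabanUV.T4Continuum.RegionStarLineGaugeTower (orthSlice_one orbitConst_le)
open Summit.QuantumFields.BalabanUV.T4Continuum.DirichletRegionTower (gamD gamD_pos)
open Summit.QuantumFields.BalabanUV.T4Continuum.RegionCollarFold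
open Summit.QuantumFields.BalabanUV.T4Continuum.RegionCollarCutoff
open Summit.QuantumFields.BalabanUV.T4Continuum.RegionCollarLift
open Summit.QuantumFields.BalabanUV.T4Continuum.RegionGaugeHoled
open Summit.QuantumFields.BalabanUV.T4Continuum.RegionGaugeScattered (liftE)
open Summit.QuantumFields.BalabanUV.Beta.GAN24.DirichletBoxCompression (toBlock_mulVec')
open Summit.QuantumFields.BalabanUV.Beta.GAN24.DirichletBoxTrace (blockReg)

variable {d : ℕ} (n : ℕ) [NeZero n] (M : Fin d → ℕ) [hM : ∀ μ, NeZero (M μ)] (E : Finset (Tor M)) (a a' : ℝ)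


/-! ## §1 Sparse hole sets: the cover by collars has multiplicity `≤ 3^d` -/

/-- a site of a hole `w′ ∈ E` is not in the collar of another hole `w ∈ E` (sparseness, verbatim). [folklore] -/
theorem not_mem_collar_of_blockOf (hfar : ∀ w ∈ E, ∀ w' ∈ E, w ≠ w' → ∀ k : Fin d → Fin 3, cblk M w k ≠ w')
    {w w' : Tor M} (hw : w ∈ E) (hw' : w' ∈ E) (hne : w ≠ w') {x : Tor (fine n M)} (hx : blockOf n M x = w') :
    x ∉ collar n M w := by
  intro hxc
  exact hfar w hw w' hw' hne (kfin n M w x hxc) (by rw [← blockOf_eq_cblk n M w x hxc, hx])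

/-- **`λ = μ̃` ON EVERY HOLE** (`3 ≤ M_ν`). [folklore] -/
theorem liftE_of_blockOf (hM3 : ∀ μ, 3 ≤ M μ) (hfar : ∀ w ∈ E, ∀ w' ∈ E, w ≠ w' → ∀ k : Fin d → Fin 3, cblk M w k ≠ w')
    (μt : Tor (fine n M) → ℂ) {x : Tor (fine n M)} {w₀ : Tor M} (hw₀ : w₀ ∈ E) (hx : blockOf n M x = w₀) :
    liftE n M E μt x = μt x := by
  have hM2 : ∀ μ, 2 ≤ M μ := fun μ => le_of_lt (hM3 μ)
  rw [liftE, Finset.sum_apply, ← Finset.add_sum_erase E _ hw₀, lift_of_blockOf_eq n M w₀ hM2 μt hx]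
  rw [Finset.sum_eq_zero, add_zero]
  intro w hw
  exact lift_of_not_mem n M w μt (not_mem_collar_of_blockOf n M E hfar (mem_of_mem_erase hw) hw₀ (ne_of_mem_erase hw) hx)

/-- **AT MOST `3^d` COLLARS THROUGH A SITE**: the holes whose collar contains `x` inject into `{0,1,2}^d` by their offset vector at `x`.
[folklore] -/
theorem card_collars_le (x : Tor (fine n M)) : (E.filter fun w => x ∈ collar n M w).card ≤ 3 ^ d := by
  classical
  set N := E.filter fun w => x ∈ collar n M w with hN
  let φ : Tor M → (Fin d → Fin 3) := fun w => if h : x ∈ collar n M w then kfin n M w x h else fun _ => 0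
  have hcard : N.card ≤ (Finset.univ : Finset (Fin d → Fin 3)).card := by
    refine Finset.card_le_card_of_injOn φ (fun _ _ => Finset.mem_coe.2 (mem_univ _)) ?_
    intro w hw w' hw' h
    have hxw : x ∈ collar n M w := (mem_filter.1 (Finset.mem_coe.1 hw)).2
    have hxw' : x ∈ collar n M w' := (mem_filter.1 (Finset.mem_coe.1 hw')).2
    have hk : kfin n M w x hxw = kfin n M w' x hxw' := by
      have := h
      simp only [φ, dif_pos hxw, dif_pos hxw'] at this
      exact this
    -- equal offsets at `x` ⟹ equal corner blocks ⟹ equal holes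
    funext ν
    have hν := congrArg (fun k : Fin d → Fin 3 => ((k ν : ℕ) : ZMod (M ν))) hk
    simp only [kfin, koff, ZMod.natCast_zmod_val] at hν
    -- `b − (w ν − 1) = b − (w' ν − 1)`
    have := sub_right_injective hν
    simpa using this
  simpa [card_offsets] using hcard

/-- **THE GRADIENT OF `λ` WITH MULTIPLICITY**: `nsq (∂λ) ≤ 3^d·Σ_{w ∈ E} nsq (∂ lift_w μ̃)`. [folklore] -/
theorem nsq_grad_liftE_le (hM3 : ∀ μ, 3 ≤ M μ) (μt : Tor (fine n M) → ℂ) :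
    nsq (GradOp (fine n M) (n : ℂ) *ᵥ liftE n M E μt) ≤ 3 ^ d * ∑ w ∈ E, nsq (GradOp (fine n M) (n : ℂ) *ᵥ lift n M w μt) := by
  classical
  have hlin : GradOp (fine n M) (n : ℂ) *ᵥ liftE n M E μt = ∑ w ∈ E, GradOp (fine n M) (n : ℂ) *ᵥ lift n M w μt := by
    rw [liftE, Matrix.mulVec_sum]
  unfold nsq
  rw [Finset.sum_comm, Finset.mul_sum]
  refine sum_le_sum fun b _ => ?_
  rw [hlin, Finset.sum_apply]
  obtain ⟨x, ρ⟩ := b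
  set f : Tor M → ℂ := fun w => (GradOp (fine n M) (n : ℂ) *ᵥ lift n M w μt) (x, ρ) with hf
  set N := E.filter fun w => x ∈ collar n M w with hN
  have hzero : ∀ w ∈ E, w ∉ N → f w = 0 := by
    intro w hw hwN
    have hx : x ∉ collar n M w := fun h => hwN (mem_filter.2 ⟨hw, h⟩)
    rw [hf]
    simp only
    rw [GradOp_mulVec, sdiff_mulVec, lift_step_of_not_mem n M w hM3 μt hx ρ, mul_zero]
  have hsub : N ⊆ E := filter_subset _ _
  have hsumN : ∑ w ∈ E, f w = ∑ w ∈ N, f w := (Finset.sum_subset hsub (fun w hw hwN => hzero w hw hwN)).symm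
  change ‖∑ w ∈ E, f w‖ ^ 2 ≤ 3 ^ d * ∑ w ∈ E, ‖f w‖ ^ 2
  rw [hsumN]
  have hcard := card_collars_le n M E x
  calc ‖∑ w ∈ N, f w‖ ^ 2 ≤ (∑ w ∈ N, ‖f w‖) ^ 2 := by
        have := norm_sum_le N f
        have h0 : 0 ≤ ‖∑ w ∈ N, f w‖ := norm_nonneg _
        nlinarith
    _ ≤ N.card * ∑ w ∈ N, ‖f w‖ ^ 2 := sq_sum_le_card_mul_sum_sq
    _ ≤ 3 ^ d * ∑ w ∈ N, ‖f w‖ ^ 2 :=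
        mul_le_mul_of_nonneg_right (by exact_mod_cast hcard) (sum_nonneg fun _ _ => by positivity)
    _ ≤ 3 ^ d * ∑ w ∈ E, ‖f w‖ ^ 2 :=
        mul_le_mul_of_nonneg_left (sum_le_sum_of_subset_of_nonneg hsub fun _ _ _ => by positivity) (by positivity)

/-! ## §2 The constant -/

/-- `K₂(d) = 2 + 4(d+1)·9^d` (the multiplicity `3^d` on top of `Kholed`'s `3^d`). [folklore] -/
def Ksparse (d : ℕ) : ℝ := 2 + 4 * ((d : ℝ) + 1) * 9 ^ d

/-- **THE W1 CONSTANT OF THE SPARSE CLASS**. [folklore] -/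
def sparseConst (d : ℕ) (a a' : ℝ) : ℝ :=
  orbitConst d a (Ksparse d / gamD d a) (Ksparse d * a / gamD d a) / (1 + 4 * d / sigma0 d a')

omit hM in
/-- `0 ≤ K₂ a/γ_D`. [folklore] -/
theorem KC₂_nonneg' (ha : 0 < a) : 0 ≤ Ksparse d * a / gamD d a := by
  have := gamD_pos (d := d) a
  have : 0 ≤ Ksparse d := by unfold Ksparse; positivity
  positivity

omit hM in
/-- `0 < sparseConst d a a′` (`0 < a`, `0 < a′`). [folklore] -/
theorem sparseConst_pos (ha : 0 < a) (ha' : 0 < a') : 0 < sparseConst d a a' := by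
  unfold sparseConst
  have := sigma0_pos (d := d) ha'
  have := orbitConst_pos d (C₁ := Ksparse d / gamD d a) (C₂ := Ksparse d * a / gamD d a) ha (KC₂_nonneg' a ha)
  positivity

/-! ## §3 The gauge–Poincaré inequality on the complement of a sparse set -/

/-- **THE GAUGE–POINCARÉ INEQUALITY ON `T ∖ E`** (`E` sparse, `3 ≤ M_ν`, `1 ≤ n`, `0 < a`, `0 < a′`): every star field `A` has a
DIRICHLET gauge `μ` on `Ω(S)` with `nsq (A − ∂_Ω μ) ≤ (K₂/γ_D)·nsq (curlR A) + (K₂ a/γ_D)·(n^d·nsq (avgR A))`, `K₂ = 2 + 4(d+1)9^d`. [folklore] -/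
theorem gaugePoincare_sparse (hM3 : ∀ μ, 3 ≤ M μ)
    (hfar : ∀ w ∈ E, ∀ w' ∈ E, w ≠ w' → ∀ k : Fin d → Fin 3, cblk M w k ≠ w')
    (hn : 1 ≤ n) (ha : 0 < a) (ha' : 0 < a') (A : {b // starReg n M (fun y : Tor M => y ∉ E) b} → ℂ) :
    ∃ μ : {x // blockReg n M (fun y : Tor M => y ∉ E) x} → ℂ,
      nsq (A - gradR n M (fun y : Tor M => y ∉ E) *ᵥ μ) ≤ Ksparse d / gamD d a * nsq (curlR n M (fun y : Tor M => y ∉ E) *ᵥ A)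
        + Ksparse d * a / gamD d a * ((n : ℝ) ^ d * nsq (avgR n M (fun y : Tor M => y ∉ E) *ᵥ A)) := by
  classical
  obtain ⟨μt, hQ, hμt⟩ := exists_torus_gauge n M a a' (fun y : Tor M => y ∉ E) hn ha ha' A
  set R : Tor (fine n M) × Fin d → ℂ := fun b => ext (starReg n M (fun y : Tor M => y ∉ E)) A b - (GradOp (fine n M) (n : ℂ) *ᵥ μt) b with hR
  set lam := liftE n M E μt with hlam
  refine ⟨fun x => μt x.1 - lam x.1, ?_⟩
  have hext : ext (blockReg n M (fun y : Tor M => y ∉ E)) (fun x : {x // blockReg n M (fun y : Tor M => y ∉ E) x} => μt x.1 - lam x.1) = μt - lam := by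
    funext x
    by_cases hx : blockReg n M (fun y : Tor M => y ∉ E) x
    · exact ext_apply_of (blockReg n M (fun y : Tor M => y ∉ E)) _ ⟨x, hx⟩
    · rw [ext_apply_of_not _ _ hx, Pi.sub_apply]
      have hw : blockOf n M x ∈ E := by
        by_contra h
        exact hx h
      rw [hlam, liftE_of_blockOf n M E hM3 hfar μt hw rfl, sub_self]
  have hres : ext (starReg n M (fun y : Tor M => y ∉ E)) (A - gradR n M (fun y : Tor M => y ∉ E) *ᵥ fun x => μt x.1 - lam x.1)
      = fun b => if starReg n M (fun y : Tor M => y ∉ E) b then R b + (GradOp (fine n M) (n : ℂ) *ᵥ lam) b else 0 := by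
    funext b
    by_cases hb : starReg n M (fun y : Tor M => y ∉ E) b
    · rw [if_pos hb, ext_apply_of (starReg n M (fun y : Tor M => y ∉ E)) _ ⟨b, hb⟩, Pi.sub_apply, gradR, toBlock_mulVec', hext, hR]
      simp only
      rw [Matrix.mulVec_sub, Pi.sub_apply, ext_apply_of (starReg n M (fun y : Tor M => y ∉ E)) A ⟨b, hb⟩]
      ring
    · rw [if_neg hb, ext_apply_of_not _ _ hb]
  -- energies
  have hgrad : nsq (GradOp (fine n M) (n : ℂ) *ᵥ lam) ≤ 3 ^ d * ((2 * 3 ^ d + 2 * d * 3 ^ d) * nsq R) := by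
    have h1 := nsq_grad_liftE_le n M E hM3 μt
    have h2 := sum_gradSum_le_residual n M (fun y : Tor M => y ∉ E) E (fun w hw h => h hw) A μt
    have h33 : (0 : ℝ) ≤ 2 * d * 3 ^ d := by positivity
    have h22 : (0 : ℝ) ≤ 2 * 3 ^ d := by positivity
    have hw : ∀ w ∈ E, nsq (GradOp (fine n M) (n : ℂ) *ᵥ lift n M w μt) ≤ (2 * 3 ^ d + 2 * d * 3 ^ d) * ∑ ρ, gradSum n M w μt ρ := by
      intro w _
      have h3 := mass_le_gradSum n M w μt (hQ w)
      calc nsq (GradOp (fine n M) (n : ℂ) *ᵥ lift n M w μt)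
          ≤ 2 * 3 ^ d * ∑ ρ, gradSum n M w μt ρ + 2 * d * 3 ^ d * ∑ j : Fin d → Fin n, ‖μt (bpt n M w j)‖ ^ 2 :=
            nsq_grad_lift_le n M w hM3 μt
        _ ≤ 2 * 3 ^ d * ∑ ρ, gradSum n M w μt ρ + 2 * d * 3 ^ d * ∑ ρ, gradSum n M w μt ρ :=
            add_le_add le_rfl (mul_le_mul_of_nonneg_left h3 h33)
        _ = _ := by ring
    have h3d : (0 : ℝ) ≤ 3 ^ d := by positivity
    calc nsq (GradOp (fine n M) (n : ℂ) *ᵥ lam) ≤ 3 ^ d * ∑ w ∈ E, nsq (GradOp (fine n M) (n : ℂ) *ᵥ lift n M w μt) := h1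
      _ ≤ 3 ^ d * ∑ w ∈ E, (2 * 3 ^ d + 2 * d * 3 ^ d) * ∑ ρ, gradSum n M w μt ρ := mul_le_mul_of_nonneg_left (sum_le_sum hw) h3d
      _ = 3 ^ d * ((2 * 3 ^ d + 2 * d * 3 ^ d) * ∑ w ∈ E, ∑ ρ, gradSum n M w μt ρ) := by congr 1; rw [← mul_sum]
      _ ≤ 3 ^ d * ((2 * 3 ^ d + 2 * d * 3 ^ d) * nsq R) :=
          mul_le_mul_of_nonneg_left (mul_le_mul_of_nonneg_left h2 (by positivity)) h3d
  have hsum : nsq (A - gradR n M (fun y : Tor M => y ∉ E) *ᵥ fun x => μt x.1 - lam x.1) ≤ 2 * nsq R + 2 * nsq (GradOp (fine n M) (n : ℂ) *ᵥ lam) := by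
    rw [← nsq_ext (starReg n M (fun y : Tor M => y ∉ E)), hres]
    unfold nsq
    rw [mul_sum, mul_sum, ← sum_add_distrib]
    refine sum_le_sum fun b _ => ?_
    dsimp only
    split_ifs
    · have := norm_add_le (R b) ((GradOp (fine n M) (n : ℂ) *ᵥ lam) b)
      nlinarith [norm_nonneg (R b + (GradOp (fine n M) (n : ℂ) *ᵥ lam) b), norm_nonneg (R b),
        norm_nonneg ((GradOp (fine n M) (n : ℂ) *ᵥ lam) b), sq_nonneg (‖R b‖ - ‖(GradOp (fine n M) (n : ℂ) *ᵥ lam) b‖)]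
    · rw [norm_zero]
      nlinarith [norm_nonneg (R b), norm_nonneg ((GradOp (fine n M) (n : ℂ) *ᵥ lam) b)]
  have hγ := gamD_pos (d := d) a
  have hRle : nsq R ≤ (nsq (curlR n M (fun y : Tor M => y ∉ E) *ᵥ A) + a * (n : ℝ) ^ d * nsq (avgR n M (fun y : Tor M => y ∉ E) *ᵥ A)) / gamD d a := by
    rw [le_div_iff₀ hγ, mul_comm]; exact hμt
  have hK : nsq (A - gradR n M (fun y : Tor M => y ∉ E) *ᵥ fun x => μt x.1 - lam x.1) ≤ Ksparse d * nsq R := by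
    have h9 : (9 : ℝ) ^ d = 3 ^ d * 3 ^ d := by rw [← mul_pow]; norm_num
    calc nsq (A - gradR n M (fun y : Tor M => y ∉ E) *ᵥ fun x => μt x.1 - lam x.1)
        ≤ 2 * nsq R + 2 * (3 ^ d * ((2 * 3 ^ d + 2 * d * 3 ^ d) * nsq R)) := by linarith [hsum, hgrad]
      _ = Ksparse d * nsq R := by rw [Ksparse, h9]; ring
  have hKpos : 0 ≤ Ksparse d := by unfold Ksparse; positivity
  calc nsq (A - gradR n M (fun y : Tor M => y ∉ E) *ᵥ fun x => μt x.1 - lam x.1) ≤ Ksparse d * nsq R := hK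
    _ ≤ Ksparse d * ((nsq (curlR n M (fun y : Tor M => y ∉ E) *ᵥ A) + a * (n : ℝ) ^ d * nsq (avgR n M (fun y : Tor M => y ∉ E) *ᵥ A)) / gamD d a) :=
        mul_le_mul_of_nonneg_left hRle hKpos
    _ = _ := by simp only [div_eq_mul_inv]; ring

/-! ## §4 ENDs: W1 on the complement of a sparse block set -/

/-- **W1 IN ORBIT FORM ON `T ∖ E`, EVERY LEVEL `n ≥ 1`** (`E` sparse, `3 ≤ M_ν`). [folklore] -/
theorem orthSlice_sparse (hM3 : ∀ μ, 3 ≤ M μ)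
    (hfar : ∀ w ∈ E, ∀ w' ∈ E, w ≠ w' → ∀ k : Fin d → Fin 3, cblk M w k ≠ w') (ha : 0 < a) (ha' : 0 < a') :
    OrthSliceCoercive (curlR n M (fun y : Tor M => y ∉ E)) (gradR n M (fun y : Tor M => y ∉ E)) (QOm n M (fun y : Tor M => y ∉ E)) (avgR n M (fun y : Tor M => y ∉ E)) (a * (n : ℝ) ^ d)
      (orbitConst d a (Ksparse d / gamD d a) (Ksparse d * a / gamD d a)) := by
  by_cases hn : 2 ≤ n
  · exact orthSlice_of_gaugePoincare n M a (fun y : Tor M => y ∉ E) hn ha (KC₂_nonneg' a ha)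
      (gaugePoincare_sparse n M E a a' hM3 hfar (by omega) ha ha')
  · obtain rfl : n = 1 := by have := NeZero.ne n; omega
    exact orthSlice_one M (fun y : Tor M => y ∉ E) a (orbitConst_le ha (KC₂_nonneg' a ha))

/-- **THE DISPLAYED W1 INEQUALITY ON THE COMPLEMENT OF ANY SPARSE BLOCK SET — ONE LEVEL-UNIFORM CONSTANT** `sparseConst d a a′` (free
of `n`, `M`, `E`): `SliceCoercive (curlR n M S) (gradR n M S) (GOm n M a′ S) (QOm n M S) (avgR n M S) (a·n^d) (sparseConst d a a′)` for
`S = T ∖ E`, `3 ≤ M_ν`, `n ≥ 1`, `0 < a`, `0 < a′`. [folklore] -/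
theorem sliceCoercive_sparse (hM3 : ∀ μ, 3 ≤ M μ)
    (hfar : ∀ w ∈ E, ∀ w' ∈ E, w ≠ w' → ∀ k : Fin d → Fin 3, cblk M w k ≠ w') (ha : 0 < a) (ha' : 0 < a') :
    SliceCoercive (curlR n M (fun y : Tor M => y ∉ E)) (gradR n M (fun y : Tor M => y ∉ E)) (GOm n M a' (fun y : Tor M => y ∉ E)) (QOm n M (fun y : Tor M => y ∉ E)) (avgR n M (fun y : Tor M => y ∉ E)) (a * (n : ℝ) ^ d) (sparseConst d a a') :=
  sliceCoercive_region_of_orthSlice n M a a' (fun y : Tor M => y ∉ E) ha' (orbitConst_pos d ha (KC₂_nonneg' a ha)).le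
    (orthSlice_sparse n M E a a' hM3 hfar ha ha')

/-- coercivity of `Δ_a(Ω₀)` on `T ∖ E` (`E` sparse), uniformly in the level. [folklore] -/
theorem coercive_regionDeltaA_sparse (hM3 : ∀ μ, 3 ≤ M μ)
    (hfar : ∀ w ∈ E, ∀ w' ∈ E, w ≠ w' → ∀ k : Fin d → Fin 3, cblk M w k ≠ w') (ha : 0 < a) (ha' : 0 < a') :
    Coercive (regionDeltaA n M a a' (fun y : Tor M => y ∉ E))
      (min (orbitConst d a (Ksparse d / gamD d a) (Ksparse d * a / gamD d a) / (1 + 4 * d / sigma0 d a') / 2)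
        (1 / (2 * (gammaPs d a')⁻¹))) :=
  coercive_regionDeltaA_of_orthSlice n M a a' (fun y : Tor M => y ∉ E) ha' (orbitConst_pos d ha (KC₂_nonneg' a ha)) (orthSlice_sparse n M E a a' hM3 hfar ha ha')

/-- «`G(Ω₀)` exists with a level-uniform bound» on `T ∖ E` (`E` sparse). [folklore] -/
theorem opNorm_inv_regionDeltaA_sparse_le (hM3 : ∀ μ, 3 ≤ M μ)
    (hfar : ∀ w ∈ E, ∀ w' ∈ E, w ≠ w' → ∀ k : Fin d → Fin 3, cblk M w k ≠ w') (ha : 0 < a) (ha' : 0 < a') :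
    ‖(regionDeltaA n M a a' (fun y : Tor M => y ∉ E))⁻¹‖
      ≤ (min (orbitConst d a (Ksparse d / gamD d a) (Ksparse d * a / gamD d a) / (1 + 4 * d / sigma0 d a') / 2)
          (1 / (2 * (gammaPs d a')⁻¹)))⁻¹ :=
  opNorm_inv_regionDeltaA_le_of_orthSlice n M a a' (fun y : Tor M => y ∉ E) ha' (orbitConst_pos d ha (KC₂_nonneg' a ha))
    (orthSlice_sparse n M E a a' hM3 hfar ha ha')

/-- **THE STAR-TOWER W1 SOCKET DISCHARGED ON `T ∖ E`** (`E` sparse): `∀ k, SliceCoercive (… lev L k …) (sparseConst d a a′)`. [folklore] -/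
theorem sliceCoercive_lev_sparse (L : ℕ) [NeZero L] (hM3 : ∀ μ, 3 ≤ M μ)
    (hfar : ∀ w ∈ E, ∀ w' ∈ E, w ≠ w' → ∀ k : Fin d → Fin 3, cblk M w k ≠ w') (ha : 0 < a) (ha' : 0 < a') (k : ℕ) :
    SliceCoercive (curlR (lev L k) M (fun y : Tor M => y ∉ E)) (gradR (lev L k) M (fun y : Tor M => y ∉ E)) (GOm (lev L k) M a' (fun y : Tor M => y ∉ E)) (QOm (lev L k) M (fun y : Tor M => y ∉ E)) (avgR (lev L k) M (fun y : Tor M => y ∉ E))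
      (a * ((lev L k : ℕ) : ℝ) ^ d) (sparseConst d a a') :=
  sliceCoercive_sparse (lev L k) M E a a' hM3 hfar ha ha'

end Summit.QuantumFields.BalabanUV.T4Continuum.RegionGaugeSparse

end
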